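import Summits.Ventures.HodgeRepro2.T5SU11SphericalStrict

/-!
# The product formula of the spherical functions of `SU(1,1)`:
`∫_K φ_λ(g k h) dk = φ_λ(g) φ_λ(h)` — Harish-Chandra's functional equation

The Iwasawa `A`-projection `t` of `T5SU11IwasawaProjection` satisfies the **cocycle identity**
`t(x y) = t(x) + t(k(x) y)` (`iwasawaT_mul`: write `x = n_{s(x)} a_{t(x)} k(x)` and use
`t(n g) = t(g)`, `t(a_τ g) = t(g) + τ`). Hence for `sph λ g = ∫_K e^{λ t(v g)} dv` and `k ∈ K`:
`e^{λ t(v g k h)} = e^{λ t(v g)} · e^{λ t(k(v g) k · h)}`, and integrating in `k` against the left-invariant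
probability measure `dk` (`integral_mul_left_eq_self`) gives `sph λ h`; Fubini on `K × K`
(`integral_integral_swap`, the integrand being continuous — `continuous_iwasawaT`) then yields the
**product formula** `∫_K sph λ (g k h) dk = sph λ g · sph λ h` (`integral_sph_mul_rot_mul`): together
with bi-`K`-invariance, continuity and `sph λ 1 = 1` (`sph_isSpherical`), `sph λ` is a spherical
function in Harish-Chandra's sense, for every `λ ∈ ℝ` (uniqueness among spherical functions is not
claimed here); at `h = g⁻¹` the formula reads `∫_K sph λ (g k g⁻¹) dk = sph λ g ^ 2`
(`integral_sph_mul_rot_mul_inv`). Nothing is claimed about (N).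

Blind lane: Mathlib + the HodgeRepro2 prefix only; no sorry; axioms ⊆ {propext, Classical.choice,
Quot.sound}.
-/

namespace Summit.Ventures.HodgeRepro2.T5SU11SphericalProduct

open MeasureTheory Metric Set Filter Topology Complex
open T5SU11Unimodular T5SU11Fibration T5SU11Cartan T5SU11OneParameter T5SU11CartanProjection
  T5HaarCircle T5BergmanCoefficient T5SU11SphericalFunction T5SU11SphericalTwo
  T5SU11SphericalSymmetry T5SU11SphericalBounds T5SU11SphericalContinuous
  T5SU11SphericalAsymptotic T5SU11SphericalLp T5SU11SphericalCfun T5SU11SphericalLpSharp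
  T5SU11SphericalXiLog T5SU11SphericalCfunLimit T5SU11SphericalStrict
  T5SU11IwasawaProjection T5SU11HorocycleTransitive T5SU11BorelHaarNA T5SU11UnipotentSubgroup
open scoped Real

/-! ### The cocycle identity of the Iwasawa `A`-projection -/

/-- `iwasawaNA g = n_{s(g)} a_{t(g)}`. -/
lemma iwasawaNA_eq (g : SU11) : iwasawaNA g = unip (iwasawaS g) * hyp (iwasawaT g) := rfl

/-- **The cocycle identity**: `t(x y) = t(x) + t(k(x) y)`. -/
theorem iwasawaT_mul (x y : SU11) :
    iwasawaT (x * y) = iwasawaT x + iwasawaT (rot (iwasawaK x) * y) := by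
  conv_lhs => rw [eq_iwasawaNA_mul_rot x]
  rw [iwasawaNA_eq, mul_assoc, mul_assoc, iwasawaT_unip_mul, iwasawaT_hyp_mul, add_comm]

/-! ### Continuity of the Iwasawa `A`-projection -/

/-- `g ↦ (1 + g·0)/(1 - g·0)` is continuous on `SU(1,1)`. -/
lemma continuous_half_orbit : Continuous fun g : SU11 => half (orbit g) := by
  simp only [half]
  refine (continuous_const.add continuous_orbit).div (continuous_const.sub continuous_orbit)
    fun g => ?_
  intro h
  rw [sub_eq_zero] at h
  have := orbit_mem_ball g
  rw [mem_ball_zero_iff, ← h, norm_one] at this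
  exact lt_irrefl _ this

/-- **`iwasawaT` is continuous on `SU(1,1)`.** -/
theorem continuous_iwasawaT : Continuous iwasawaT := by
  unfold iwasawaT
  refine (Continuous.log (Complex.continuous_re.comp continuous_half_orbit) fun g => ?_).div_const 2
  rw [Function.comp_apply, half_re (orbit_mem_ball g)]
  exact (poisson_pos (orbit_mem_ball g)).ne'

/-- The integrand of the product formula, `(u, v) ↦ e^{λ t(v · g u h)}`, is continuous on `K × K`. -/
lemma continuous_product_integrand (lam : ℝ) (g h : SU11) :
    Continuous fun p : Circle × Circle =>
      Real.exp (lam * iwasawaT (rot p.2 * (g * rot p.1 * h))) :=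
  Real.continuous_exp.comp (continuous_const.mul (continuous_iwasawaT.comp
    ((continuous_rot.comp continuous_snd).mul
      ((continuous_const.mul (continuous_rot.comp continuous_fst)).mul continuous_const))))

/-! ### The product formula -/

section measure

variable [MeasurableSpace Circle] [BorelSpace Circle]

/-- **The product formula**: `∫_K sph λ (g k h) dk = sph λ g · sph λ h`. -/
theorem integral_sph_mul_rot_mul (lam : ℝ) (g h : SU11) :
    ∫ u, sph lam (g * rot u * h) ∂haarCircle = sph lam g * sph lam h := by
  have hint : Integrable (Function.uncurry fun u v : Circle =>
      Real.exp (lam * iwasawaT (rot v * (g * rot u * h)))) (haarCircle.prod haarCircle) :=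
    (continuous_product_integrand lam g h).integrable_of_hasCompactSupport
      (HasCompactSupport.of_compactSpace _)
  have e1 : ∀ u : Circle, sph lam (g * rot u * h) =
      ∫ v, Real.exp (lam * iwasawaT (rot v * (g * rot u * h))) ∂haarCircle := fun u => rfl
  simp_rw [e1]
  rw [integral_integral_swap hint]
  have e2 : ∀ v : Circle, ∫ u, Real.exp (lam * iwasawaT (rot v * (g * rot u * h))) ∂haarCircle =
      Real.exp (lam * iwasawaT (rot v * g)) * sph lam h := by
    intro v
    have e3 : ∀ u : Circle, Real.exp (lam * iwasawaT (rot v * (g * rot u * h))) =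
        Real.exp (lam * iwasawaT (rot v * g)) *
          Real.exp (lam * iwasawaT (rot (iwasawaK (rot v * g) * u) * h)) := by
      intro u
      rw [← Real.exp_add, ← mul_add]
      congr 2
      rw [show rot v * (g * rot u * h) = rot v * g * (rot u * h) by simp only [mul_assoc],
        iwasawaT_mul (rot v * g) (rot u * h), ← mul_assoc, ← map_mul]
    simp_rw [e3]
    rw [integral_const_mul]
    congr 1
    exact integral_mul_left_eq_self (fun w : Circle => Real.exp (lam * iwasawaT (rot w * h)))
      (iwasawaK (rot v * g))
  simp_rw [e2]
  rw [integral_mul_const]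
  rfl

/-- **The product formula in the order `h k g`**: `∫_K sph λ (h k g) dk = sph λ g · sph λ h`. -/
theorem integral_sph_mul_rot_mul' (lam : ℝ) (g h : SU11) :
    ∫ u, sph lam (h * rot u * g) ∂haarCircle = sph lam g * sph lam h := by
  rw [integral_sph_mul_rot_mul, mul_comm]

/-- **`sph λ` is a spherical function in Harish-Chandra's sense**: continuous, normalised,
bi-`K`-invariant, and satisfying the product formula. -/
theorem sph_isSpherical (lam : ℝ) :
    Continuous (sph lam) ∧ sph lam 1 = 1 ∧
      (∀ (u v : Circle) (g : SU11), sph lam (rot u * g * rot v) = sph lam g) ∧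
      ∀ g h : SU11, ∫ u, sph lam (g * rot u * h) ∂haarCircle = sph lam g * sph lam h :=
  ⟨continuous_sph lam, sph_one lam, fun u v g => sph_rot_mul_rot lam u v g,
    fun g h => integral_sph_mul_rot_mul lam g h⟩

/-- **The product formula at `h = g⁻¹`**: `∫_K sph λ (g k g⁻¹) dk = sph λ g ^ 2`. -/
theorem integral_sph_mul_rot_mul_inv (lam : ℝ) (g : SU11) :
    ∫ u, sph lam (g * rot u * g⁻¹) ∂haarCircle = sph lam g ^ 2 := by
  rw [integral_sph_mul_rot_mul, sph_inv, sq]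

end measure

end Summit.Ventures.HodgeRepro2.T5SU11SphericalProduct
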